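import Summits.CriticalPhenomena.CardyFormulaZ2.Theorems.CardyFlipRussoSquareFromVoronoiHubProductLegDefs
import Summits.CriticalPhenomena.CardyFormulaZ2.Theorems.CardyFlipRussoSquareFromVoronoiHubJsdEdges
import Summits.CriticalPhenomena.CardyFormulaZ2.Theorems.CardyFlipRussoSquareFromVoronoiHubJsdKing
import Summits.CriticalPhenomena.CardyFormulaZ2.Theorems.CardyFlipRussoSquareFromVoronoiHubFaceDiagonal
import Summits.CriticalPhenomena.CardyFormulaZ2.Theorems.CardyFlipRussoSquareFromVoronoiHubCrossingDelaunay
import Summits.CriticalPhenomena.CardyFormulaZ2.Theorems.CardyFlipRussoSquareFromVoronoiHubFaceDiagonalsCross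
import Summits.CriticalPhenomena.CardyFormulaZ2.Theorems.CardyFlipRussoSquareFromVoronoiHubConcyclicNull
import Summits.CriticalPhenomena.CardyFormulaZ2.Theorems.CardyFlipRussoSquareFromVoronoiHubDiagonalSymmetry
import Summits.CriticalPhenomena.CardyFormulaZ2.Theorems.CardyFlipRussoSquareFromVoronoiHubEndpointField
import Literature.Probability.LatticeModels.DelaunayGraph
import HarnessLib

/-!
# Line `SketchIdeator5R2` (card `one-product-leg`) for crux `SquareFromVoronoiHub`
# (stmt-CriticalPhenomena-6434, route `CardyFlipRusso`, sub-problem `CardyFormulaZ2`) — lead a1 skeleton v5 (after wave 2 + endpoint assembly)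

The line (card `Cruxes/SquareFromVoronoiHub/Ideas/one-product-leg.md`, first lemma typed in
`Cruxes/SquareFromVoronoiHub/SketchIdeator5R2.lean`):

* **Hub factor** `stub_productLeg` (the card's C⁺, OPEN): Cardy for annealed Poisson–Voronoi
  percolation (the crux's hypothesis, `VoronoiBlocks.voronoiCrossingProb`) ⇒ Cardy for the annealed
  Voronoi colouring of the disc-jittered square lattice `ℤ² + ξ`, `ξ_v` i.i.d. uniform on the closed
  disc of radius `1/20`, colours i.i.d. fair (`jitteredCrossingProb`).  The card interpolates by
  cell-indexed independent marks (Poisson(1) blob in the cell vs. one jittered point), a product law at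
  every `t`.
* **Leg S** `stub_legS` (OPEN): Cardy for the jittered lattice ⇒ Cardy for fair site percolation on
  `ℤ²` with i.i.d. fair diagonals at the slacks `2δ`, `3δ` (`CentreDecimation.diagCrossingProb`), whose
  conjunction is crux-sufficient BY NAME through the landed
  `CentreDecimation.stub_crux_of_voronoiToRandomDiagonal` (p130258, centre-decimation identity + squeeze).
* **Endpoint geometry** (card B's first lemma `JitteredSquareDelaunay`; four registered stubs, ALL LANDED
  by wave 1: `ProductLeg.stub_jsdEdges` p138013, `stub_jsdKing` p137930, `stub_faceDiagonal` p138482,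
  `stub_crossingDelaunay_cospherical` p137979 — the stubs below are one-line wrappers): for jitter amplitude `a < (1 - 1/√2)/2` every `ℤ²`-edge of the jittered lattice is a Delaunay
  pair (`stub_jsdEdges`) and every Delaunay pair is a king move (`stub_jsdKing`, covering radius
  `1/√2 + a < 1 - a`); for `a ≤ 1/20` every face carries at least one Delaunay diagonal
  (`stub_faceDiagonal`); two crossing Delaunay pairs have concyclic endpoints
  (`stub_crossingDelaunay_cospherical`).  Together: the Delaunay graph of `ℤ² + ξ` is `ℤ²` plus exactly
  one diagonal per face off the null event of a concyclic face — the exact endpoint of the product leg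
  and the start of leg S (`jitteredSquare_delaunay_structure`, glue only).
* **Endpoint law** (wave 2, ALL LANDED; toward leg S: the Delaunay-diagonal orientation field at `t = 1`):
  `stub_faceDiagonalsCross` p139305 (the face diagonals cross, so (iv) applies), `stub_concyclicFace_null`
  p139705 (a.s. no concyclic face: exactly one diagonal per face a.s.), `stub_diagonal_reflection_symm`
  p139457 (the two orientations are equally likely: the field is fair); assembled by the lead in
  `Theorems/CardyFlipRussoSquareFromVoronoiHubEndpointField.lean` (`stub_endpointField`, p139856: a.s.
  EXACTLY one Delaunay diagonal per face; `one_le_two_mul_measure_diagSWNE`: each orientation has outer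
  probability ≥ 1/2).

Composition: `SquareFromVoronoiHub_of : crux := stub_legsGlue stub_productLeg stub_legS` (glue stub (vii),
sorry-free).  Sorries live only in `stub_productLeg` / `stub_legS`.
-/

noncomputable section

open scoped Topology MeasureTheory
open Filter Set MeasureTheory Metric
open Literature.Analysis.FunctionSpaces (PointConfig IsPoissonPointProcess)
open Literature.Probability.RandomPlanarGeometry (ConformalRectangle cardyFunction)
open Literature.Probability.Percolation (SiteConfig sitePercolation siteConnIn half voronoiCrossing)
open Literature.Probability.LatticeModels (IsDelaunayPair)
open Summit.CriticalPhenomena.CardyFormulaZ2.Cruxes.SquareFromVoronoiHub.VoronoiBlocks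
  (voronoiCrossingProb)
open Summit.CriticalPhenomena.CardyFormulaZ2.Cruxes.SquareFromVoronoiHub.CentreDecimation
  (diagCrossingProb stub_crux_of_voronoiToRandomDiagonal)
open Summit.CriticalPhenomena.CardyFormulaZ2.Cruxes.SquareFromVoronoiHub.ProductLeg
  (jitterRadius jitterLaw sqPos jitteredLaw jitterNuclei jitteredCrossingProb)

namespace Summit.CriticalPhenomena.CardyFormulaZ2.Cruxes.SquareFromVoronoiHub.ProductLegLine

/-! ### The endpoint model of the product leg

The vocabulary (`jitterRadius = 1/20`, `jitterLaw` = Lebesgue conditioned on the closed disc, `sqPos`,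
`jitteredLaw` = i.i.d. jitters ⊗ i.i.d. fair colours, `jitterNuclei`, `jitteredCrossingProb` = annealed
continuum crossing probability of the Voronoi colouring of `ℤ² + ξ`) is the LANDED definitions module
`Theorems/CardyFlipRussoSquareFromVoronoiHubProductLegDefs.lean` (p138687), opened below. -/

/-! ### Registered stubs (signatures verbatim; (i)–(iv), (vii)–(xi) landed; (v)–(vi) open) -/

/-- Stub (i) (LANDED p138013): `ℤ²`-edges are Delaunay pairs of the jittered lattice. -/
theorem stub_jsdEdges :
    ∀ (a : ℝ) (ξ : ℤ × ℤ → ℂ), 0 ≤ a → a < (1 - 1 / Real.sqrt 2) / 2 → (∀ v, ‖ξ v‖ ≤ a) →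
      ∀ v w : ℤ × ℤ, (w = (v.1 + 1, v.2) ∨ w = (v.1, v.2 + 1)) →
        IsDelaunayPair (Set.range fun u : ℤ × ℤ => ((u.1 : ℂ) + (u.2 : ℂ) * Complex.I) + ξ u)
          (((v.1 : ℂ) + (v.2 : ℂ) * Complex.I) + ξ v) (((w.1 : ℂ) + (w.2 : ℂ) * Complex.I) + ξ w) :=
  ProductLeg.stub_jsdEdges

/-- Stub (ii) (LANDED p137930): Delaunay pairs of the jittered lattice are king moves. -/
theorem stub_jsdKing :
    ∀ (a : ℝ) (ξ : ℤ × ℤ → ℂ), 0 ≤ a → a < (1 - 1 / Real.sqrt 2) / 2 → (∀ v, ‖ξ v‖ ≤ a) →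
      ∀ v w : ℤ × ℤ, v ≠ w →
        IsDelaunayPair (Set.range fun u : ℤ × ℤ => ((u.1 : ℂ) + (u.2 : ℂ) * Complex.I) + ξ u)
          (((v.1 : ℂ) + (v.2 : ℂ) * Complex.I) + ξ v) (((w.1 : ℂ) + (w.2 : ℂ) * Complex.I) + ξ w) →
        |v.1 - w.1| ≤ 1 ∧ |v.2 - w.2| ≤ 1 :=
  ProductLeg.stub_jsdKing

/-- Stub (iii) (LANDED p138482): every face carries a Delaunay diagonal. -/
theorem stub_faceDiagonal :
    ∀ (a : ℝ) (ξ : ℤ × ℤ → ℂ), 0 ≤ a → a ≤ 1 / 20 → (∀ v, ‖ξ v‖ ≤ a) →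
      ∀ v : ℤ × ℤ,
        IsDelaunayPair (Set.range fun u : ℤ × ℤ => ((u.1 : ℂ) + (u.2 : ℂ) * Complex.I) + ξ u)
            (((v.1 : ℂ) + (v.2 : ℂ) * Complex.I) + ξ v)
            ((((v.1 + 1 : ℤ) : ℂ) + ((v.2 + 1 : ℤ) : ℂ) * Complex.I) + ξ (v.1 + 1, v.2 + 1)) ∨
          IsDelaunayPair (Set.range fun u : ℤ × ℤ => ((u.1 : ℂ) + (u.2 : ℂ) * Complex.I) + ξ u)
            ((((v.1 + 1 : ℤ) : ℂ) + (v.2 : ℂ) * Complex.I) + ξ (v.1 + 1, v.2))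
            (((v.1 : ℂ) + ((v.2 + 1 : ℤ) : ℂ) * Complex.I) + ξ (v.1, v.2 + 1)) :=
  ProductLeg.stub_faceDiagonal

/-- Stub (iv) (LANDED p137979): crossing Delaunay pairs are concyclic. -/
theorem stub_crossingDelaunay_cospherical :
    ∀ (S : Set ℂ) (A B C D : ℂ), A ∈ S → B ∈ S → C ∈ S → D ∈ S →
      (∃ X : ℂ, X ∈ openSegment ℝ A C ∧ X ∈ openSegment ℝ B D) →
      IsDelaunayPair S A C → IsDelaunayPair S B D →
        ∃ (c : ℂ) (r : ℝ), dist A c = r ∧ dist B c = r ∧ dist C c = r ∧ dist D c = r :=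
  ProductLeg.stub_crossingDelaunay_cospherical

/-- Stub (viii) (LANDED p139305): the two diagonals of every face of the jittered lattice CROSS (`a ≤ 1/20`; the
quadrilateral is convex), so stub (iv) applies to faces. -/
theorem stub_faceDiagonalsCross :
    ∀ (a : ℝ) (ξ : ℤ × ℤ → ℂ), 0 ≤ a → a ≤ 1 / 20 → (∀ v, ‖ξ v‖ ≤ a) → ∀ v : ℤ × ℤ,
      ∃ X : ℂ, X ∈ openSegment ℝ (sqPos v + ξ v) (sqPos (v.1 + 1, v.2 + 1) + ξ (v.1 + 1, v.2 + 1)) ∧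
        X ∈ openSegment ℝ (sqPos (v.1 + 1, v.2) + ξ (v.1 + 1, v.2)) (sqPos (v.1, v.2 + 1) + ξ (v.1, v.2 + 1)) :=
  ProductLeg.stub_faceDiagonalsCross

/-- Stub (ix) (LANDED p139705): under the i.i.d. disc jitter law, the corners of a given face are almost surely NOT
concyclic (the fourth corner would lie on the circumcircle of the other three, a Lebesgue-null circle). -/
theorem stub_concyclicFace_null :
    ∀ v : ℤ × ℤ, Measure.infinitePi (fun _ : ℤ × ℤ => jitterLaw)
      {ξ | ∃ (c : ℂ) (r : ℝ), dist (sqPos v + ξ v) c = r ∧ dist (sqPos (v.1 + 1, v.2) + ξ (v.1 + 1, v.2)) c = r ∧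
        dist (sqPos (v.1 + 1, v.2 + 1) + ξ (v.1 + 1, v.2 + 1)) c = r ∧
        dist (sqPos (v.1, v.2 + 1) + ξ (v.1, v.2 + 1)) c = r} = 0 :=
  ProductLeg.stub_concyclicFace_null

/-- Stub (x) (LANDED p139457): the i.i.d. disc jitter law gives the two diagonal orientations of a face the same
probability (reflection of the lattice in the vertical line through the face centre, composed with the
reflection `z ↦ -conj z` of every jitter, preserves `Measure.infinitePi jitterLaw` and swaps the two
Delaunay-diagonal events). -/
theorem stub_diagonal_reflection_symm :
    ∀ v : ℤ × ℤ,
      Measure.infinitePi (fun _ : ℤ × ℤ => jitterLaw)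
          {ξ | IsDelaunayPair (Set.range fun u : ℤ × ℤ => sqPos u + ξ u) (sqPos v + ξ v)
            (sqPos (v.1 + 1, v.2 + 1) + ξ (v.1 + 1, v.2 + 1))} =
        Measure.infinitePi (fun _ : ℤ × ℤ => jitterLaw)
          {ξ | IsDelaunayPair (Set.range fun u : ℤ × ℤ => sqPos u + ξ u) (sqPos (v.1 + 1, v.2) + ξ (v.1 + 1, v.2))
            (sqPos (v.1, v.2 + 1) + ξ (v.1, v.2 + 1))} :=
  ProductLeg.stub_diagonal_reflection_symm

/-- Stub (xi) (LANDED p139856, lead's assembly of (iii), (iv), (viii), (ix)): almost surely EXACTLY ONE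
Delaunay diagonal per face of the disc-jittered square lattice. The same file proves the fairness
bounds `measure_diagSWNE_eq_measure_diagSENW`, `one_le_two_mul_measure_diagSWNE`. -/
theorem stub_endpointField :
    ∀ v : ℤ × ℤ, ∀ᵐ ξ ∂(Measure.infinitePi (fun _ : ℤ × ℤ => jitterLaw)),
      (IsDelaunayPair (Set.range fun u : ℤ × ℤ => sqPos u + ξ u) (sqPos v + ξ v)
          (sqPos (v.1 + 1, v.2 + 1) + ξ (v.1 + 1, v.2 + 1)) ∨
        IsDelaunayPair (Set.range fun u : ℤ × ℤ => sqPos u + ξ u) (sqPos (v.1 + 1, v.2) + ξ (v.1 + 1, v.2))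
          (sqPos (v.1, v.2 + 1) + ξ (v.1, v.2 + 1))) ∧
      ¬ (IsDelaunayPair (Set.range fun u : ℤ × ℤ => sqPos u + ξ u) (sqPos v + ξ v)
            (sqPos (v.1 + 1, v.2 + 1) + ξ (v.1 + 1, v.2 + 1)) ∧
          IsDelaunayPair (Set.range fun u : ℤ × ℤ => sqPos u + ξ u) (sqPos (v.1 + 1, v.2) + ξ (v.1 + 1, v.2))
            (sqPos (v.1, v.2 + 1) + ξ (v.1, v.2 + 1))) :=
  ProductLeg.stub_endpointField

/-- Stub (v): the hub factor C⁺ (OPEN). -/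
theorem stub_productLeg :
    (∀ (PB PW : Measure (PointConfig ℂ)),
        IsPoissonPointProcess (volume : Measure ℂ) PB → IsPoissonPointProcess (volume : Measure ℂ) PW →
        ∀ R : ConformalRectangle, R.HasCrossingLimit (voronoiCrossingProb PB PW R) cardyFunction) →
      ∀ R : ConformalRectangle, R.HasCrossingLimit (jitteredCrossingProb R) cardyFunction := by
  sorry

/-- Stub (vi): leg S (OPEN). -/
theorem stub_legS :
    (∀ R : ConformalRectangle, R.HasCrossingLimit (jitteredCrossingProb R) cardyFunction) →
      (∀ R : ConformalRectangle, R.HasCrossingLimit (diagCrossingProb R 2) cardyFunction) ∧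
        (∀ R : ConformalRectangle, R.HasCrossingLimit (diagCrossingProb R 3) cardyFunction) := by
  sorry

/-! ### Glue -/



/-- The endpoint structure theorem of the product leg (glue of stubs (i)–(iv)): for jitter amplitude
`a ≤ 1/20`, the Delaunay graph of `ℤ² + ξ` contains every `ℤ²`-edge, consists of king moves only,
and has at least one diagonal in every face; two crossing Delaunay diagonals force a concyclic face. -/
theorem jitteredSquare_delaunay_structure (a : ℝ) (ξ : ℤ × ℤ → ℂ) (ha0 : 0 ≤ a) (ha : a ≤ 1 / 20)
    (hξ : ∀ v, ‖ξ v‖ ≤ a) :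
    (∀ v w : ℤ × ℤ, (w = (v.1 + 1, v.2) ∨ w = (v.1, v.2 + 1)) →
      IsDelaunayPair (Set.range fun u : ℤ × ℤ => ((u.1 : ℂ) + (u.2 : ℂ) * Complex.I) + ξ u)
        (((v.1 : ℂ) + (v.2 : ℂ) * Complex.I) + ξ v) (((w.1 : ℂ) + (w.2 : ℂ) * Complex.I) + ξ w)) ∧
    (∀ v w : ℤ × ℤ, v ≠ w →
      IsDelaunayPair (Set.range fun u : ℤ × ℤ => ((u.1 : ℂ) + (u.2 : ℂ) * Complex.I) + ξ u)
        (((v.1 : ℂ) + (v.2 : ℂ) * Complex.I) + ξ v) (((w.1 : ℂ) + (w.2 : ℂ) * Complex.I) + ξ w) →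
      |v.1 - w.1| ≤ 1 ∧ |v.2 - w.2| ≤ 1) ∧
    (∀ v : ℤ × ℤ,
      IsDelaunayPair (Set.range fun u : ℤ × ℤ => ((u.1 : ℂ) + (u.2 : ℂ) * Complex.I) + ξ u)
          (((v.1 : ℂ) + (v.2 : ℂ) * Complex.I) + ξ v)
          ((((v.1 + 1 : ℤ) : ℂ) + ((v.2 + 1 : ℤ) : ℂ) * Complex.I) + ξ (v.1 + 1, v.2 + 1)) ∨
        IsDelaunayPair (Set.range fun u : ℤ × ℤ => ((u.1 : ℂ) + (u.2 : ℂ) * Complex.I) + ξ u)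
          ((((v.1 + 1 : ℤ) : ℂ) + (v.2 : ℂ) * Complex.I) + ξ (v.1 + 1, v.2))
          (((v.1 : ℂ) + ((v.2 + 1 : ℤ) : ℂ) * Complex.I) + ξ (v.1, v.2 + 1))) := by
  have hlt : a < (1 - 1 / Real.sqrt 2) / 2 := by
    have h2 : (4 : ℝ) / 3 < Real.sqrt 2 := by
      rw [Real.lt_sqrt (by norm_num)]
      norm_num
    have hpos : 0 < Real.sqrt 2 := Real.sqrt_pos.2 (by norm_num)
    have : 1 / Real.sqrt 2 < 3 / 4 := by
      rw [div_lt_iff₀ hpos]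
      linarith
    linarith
  exact ⟨stub_jsdEdges a ξ ha0 hlt hξ, stub_jsdKing a ξ ha0 hlt hξ, stub_faceDiagonal a ξ ha0 ha hξ⟩

/-- **Composition, closed form**: the registered stubs imply the crux
`CardyFlipRusso.SquareFromVoronoiHub` BY NAME — the hub factor (v) and leg S (vi) feed the landed
assembly `stub_crux_of_voronoiToRandomDiagonal` of the line centre-decimation (p130258).  Glue only;
the sorries live in `stub_productLeg` / `stub_legS`. -/
theorem SquareFromVoronoiHub_of :
    Summit.CriticalPhenomena.CardyFormulaZ2.Theses.CardyFlipRusso.SquareFromVoronoiHub :=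
  ProductLeg.stub_legsGlue stub_productLeg stub_legS

/-- Registered glue stub (vii) `stub_legsGlue` (LANDED p138687, sorry-free): the hub factor and leg S
imply the crux BY NAME through the landed centre-decimation assembly (p130258). -/
theorem stub_legsGlue :
    ((∀ (PB PW : Measure (PointConfig ℂ)),
          IsPoissonPointProcess (volume : Measure ℂ) PB → IsPoissonPointProcess (volume : Measure ℂ) PW →
          ∀ R : ConformalRectangle, R.HasCrossingLimit (voronoiCrossingProb PB PW R) cardyFunction) →
        ∀ R : ConformalRectangle, R.HasCrossingLimit (jitteredCrossingProb R) cardyFunction) →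
      ((∀ R : ConformalRectangle, R.HasCrossingLimit (jitteredCrossingProb R) cardyFunction) →
          (∀ R : ConformalRectangle, R.HasCrossingLimit (diagCrossingProb R 2) cardyFunction) ∧
            (∀ R : ConformalRectangle, R.HasCrossingLimit (diagCrossingProb R 3) cardyFunction)) →
        Summit.CriticalPhenomena.CardyFormulaZ2.Theses.CardyFlipRusso.SquareFromVoronoiHub :=
  ProductLeg.stub_legsGlue

end Summit.CriticalPhenomena.CardyFormulaZ2.Cruxes.SquareFromVoronoiHub.ProductLegLine

end
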